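import Mathlib
import HarnessLib

/-!
# The LARGE Frobenius solution `u ln|s| + v` of the continuum equation `(Pξ′)′ − Qξ = 0` at a simple zero of `P`,
# CONSTRUCTED from the small solution `u` by reduction of order — Goedbloed & Poedts (2004) §7.4.1 (7.145)–(7.148);
# Coddington–Levinson Ch. 4 §8 — PROVED, with exactly the one-sided limits consumed by `SlabAlfvenSlowContinua.lean`

Topic `Literature/MathematicalPhysics/MHD` (namespace = path; sub-namespace `SlabContinuum.ReductionOfOrder`).
Companion of `SlabAlfvenSlowContinua.lean` (GRIDFUSION lit-3), whose glue / flux / improper-eigenfunction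
theorems (`SlabContinuum.flux_large`, `flux_glue_left/right`, `flux_continuous_iff`, `exists_nontrivial_bc`) take
the Frobenius pair — the small solution `u` (`u → u₀ ≠ 0`, `u′ → u′₀`) and the large solution `u ln|s| + v`
(`v′ → v′₀`) of GP2004 (7.147)–(7.148) — as DATA.  This file halves that assumption: GIVEN the small solution `u`
(a `C¹` solution of the flux form `(sP̃u′)′ = Qu` through the singular point with `u ≠ 0`), the large solution is
CONSTRUCTED by reduction of order and PROVED to solve the equation on both sides of `s = 0`, to have the printed
shape `u ln|s| + v` with `v(0) = 0` and a derivative `v′` continuous at `0`, and to carry the Wronskian flux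
`P(uL′ − u′L) = P₁u₀²`.  (The existence of `u` itself for ANALYTIC `P̃, Q` is the exponent-`0` Frobenius branch with
`p₀ = 1`, indicial exponents `{0, 0}` — the tree's `Literature.Analysis.ODE.RegularSingularScalarBranch` /
`RegularSingularScalarSystem` regime «no positive integer `n` has `n + p₀ = 0`»; not instantiated here.)

## What is printed and what is typed
GP2004 §7.4.1: the singular equation (7.126)/(7.145) `(P ξ′)′ − Qξ = 0`, `P = s·P̃(s)`, `P̃(0) = P₁ ≠ 0`; the indicial
equation `ν² = 0` (7.146); «the second solution … contains a logarithm: `ξ₂ = u ln|s| + v`» (7.147)–(7.148), `u, v`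
power series with `u(0) ≠ 0`.  Coddington–Levinson Ch. 4 §8: the second solution at a double indicial root by
REDUCTION OF ORDER, `ξ₂ = u ∫ ds/(P u²)`.  Typed (all PROVED): with `g = 1/(P̃u²)`, `g₀ = g(0) = 1/(P₁u₀²)`, the slope
`k(s) = (g(s) − g₀)/s` (value `g′(0)` at `0`, continuous through `0`), `h(s) = ∫₀ˢ k`, `v = u·h/g₀` and
`L = u ln|s| + v`:
* `continuousOn_k`, `hasDerivAt_h` (FTC), `h_zero`;
* ★ `hasDerivAt_L`, ★★ `flux_hasDerivAt` — `L′ = u′ ln|s| + u/s + v′` and `(s P̃ L′)′ = Q L` at every `s ≠ 0` of the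
  interval: `L` IS the large solution;
* ★ `wronskian` — `s P̃ (u L′ − u′ L) = P₁u₀²` (so `L` is independent of `u`, and its flux constant is the one in
  `SlabContinuum.flux_large`);
* ★ `tendsto_v'` — `v′ → u₀ g′(0)/g₀` as `s → 0` (with `u → u₀`, `u′ → u′₀` from continuity): the hypotheses of
  `SlabContinuum.flux_large` / `flux_glue_left` / `flux_glue_right` are DISCHARGED for this `v`.
THREE COLUMNS: CERTIFIED (real analysis of the printed model equation); nothing VALIDATED; MODELLED as in GP §7.4.1.

## Sources
* J. P. Goedbloed, S. Poedts, *Principles of Magnetohydrodynamics*, CUP 2004 [GoedbloedPoedts2004] §7.4.1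
  eqs. (7.145)–(7.148) [galaxy:panama:236721417486398 chunks p0313–p0315, read 2026-08-28].
* E. A. Coddington, N. Levinson, *Theory of Ordinary Differential Equations* (1955) Ch. 4 §8 [CoddingtonLevinson1955]
  (reduction of order / the logarithmic case).
-/

noncomputable section

open Filter Set MeasureTheory intervalIntegral
open scoped Topology

namespace Literature.MathematicalPhysics.MHD

namespace SlabContinuum.ReductionOfOrder

variable {Pt Q u u' : ℝ → ℝ} {δ Pt'₀ : ℝ}

/-- THE SMALL-SOLUTION DATA of reduction of order on `(−δ, δ)`: `P̃` continuous and non-vanishing, differentiable at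
`0`; `u` a `C¹` function, non-vanishing, solving the flux form `(s P̃ u′)′ = Q u` (the small Frobenius solution of
GP2004 (7.147), `u(0) ≠ 0`). [cite: GoedbloedPoedts2004, §7.4.1 eqs. (7.145)–(7.147)] -/
structure IsSmallData (Pt Q u u' : ℝ → ℝ) (δ Pt'₀ : ℝ) : Prop where
  /-- `0 < δ` -/
  δ_pos : 0 < δ
  /-- `P̃` continuous on `(−δ, δ)` -/
  Pt_cont : ContinuousOn Pt (Ioo (-δ) δ)
  /-- `P̃ ≠ 0` on `(−δ, δ)` (a SIMPLE zero of `P = sP̃`) -/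
  Pt_ne : ∀ s ∈ Ioo (-δ) δ, Pt s ≠ 0
  /-- `P̃` differentiable at `0` -/
  Pt_deriv : HasDerivAt Pt Pt'₀ 0
  /-- `u′` is the derivative of `u` on `(−δ, δ)` -/
  u_deriv : ∀ s ∈ Ioo (-δ) δ, HasDerivAt u (u' s) s
  /-- `u′` continuous on `(−δ, δ)` -/
  u'_cont : ContinuousOn u' (Ioo (-δ) δ)
  /-- `u ≠ 0` on `(−δ, δ)` (`u(0) = u₀ ≠ 0`, shrink `δ`) -/
  u_ne : ∀ s ∈ Ioo (-δ) δ, u s ≠ 0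
  /-- `u` solves the flux form `(s P̃ u′)′ = Q u` on `(−δ, δ)` -/
  u_sol : ∀ s ∈ Ioo (-δ) δ, HasDerivAt (fun s => s * Pt s * u' s) (Q s * u s) s

/-- `g = 1/(P̃u²)` — the integrand of reduction of order is `1/(Pu²) = g/s`. [cite: CoddingtonLevinson1955, Ch. 4 §8] -/
def g (Pt u : ℝ → ℝ) (s : ℝ) : ℝ := (Pt s * u s ^ 2)⁻¹

/-- `g′(0) = −(P̃′(0)u₀² + P̃(0)·2u₀u′₀)/(P̃(0)u₀²)²`. [cite: CoddingtonLevinson1955, Ch. 4 §8] -/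
def gDeriv0 (Pt u u' : ℝ → ℝ) (Pt'₀ : ℝ) : ℝ :=
  -(Pt'₀ * u 0 ^ 2 + Pt 0 * (2 * u 0 * u' 0)) / (Pt 0 * u 0 ^ 2) ^ 2

/-- The slope `k(s) = (g(s) − g(0))/s`, `k(0) = g′(0)`: `g(s)/s = g(0)/s + k(s)` splits off the logarithm.
[cite: CoddingtonLevinson1955, Ch. 4 §8] -/
def k (Pt u u' : ℝ → ℝ) (Pt'₀ : ℝ) (s : ℝ) : ℝ :=
  if s = 0 then gDeriv0 Pt u u' Pt'₀ else (g Pt u s - g Pt u 0) / s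

/-- `h(s) = ∫₀ˢ k` — the regular part of `∫ ds/(Pu²) = g(0) ln|s| + h`. [cite: CoddingtonLevinson1955, Ch. 4 §8] -/
def h (Pt u u' : ℝ → ℝ) (Pt'₀ : ℝ) (s : ℝ) : ℝ := ∫ t in (0 : ℝ)..s, k Pt u u' Pt'₀ t

/-- `v = u·h/g(0)` — the regular part of the large solution. [cite: GoedbloedPoedts2004, §7.4.1 eq. (7.148)] -/
def v (Pt u u' : ℝ → ℝ) (Pt'₀ : ℝ) (s : ℝ) : ℝ := u s * h Pt u u' Pt'₀ s / g Pt u 0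

/-- `v′ = (u′h + u k)/g(0)`. [cite: GoedbloedPoedts2004, §7.4.1 eq. (7.148)] -/
def v' (Pt u u' : ℝ → ℝ) (Pt'₀ : ℝ) (s : ℝ) : ℝ := (u' s * h Pt u u' Pt'₀ s + u s * k Pt u u' Pt'₀ s) / g Pt u 0

/-- THE LARGE SOLUTION `L = u ln|s| + v` (7.148) (normalised: coefficient of `u ln|s|` equal to `1`).
[cite: GoedbloedPoedts2004, §7.4.1 eq. (7.148)] -/
def L (Pt u u' : ℝ → ℝ) (Pt'₀ : ℝ) (s : ℝ) : ℝ := u s * Real.log |s| + v Pt u u' Pt'₀ s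

/-- `L′ = u′ ln|s| + u/s + v′` (the shape used by `SlabContinuum.hasDerivAt_large` / `flux_large`).
[cite: GoedbloedPoedts2004, §7.4.1 eq. (7.148)] -/
def L' (Pt u u' : ℝ → ℝ) (Pt'₀ : ℝ) (s : ℝ) : ℝ := u' s * Real.log |s| + u s / s + v' Pt u u' Pt'₀ s

/-- `0 ∈ (−δ, δ)`. [cite: GoedbloedPoedts2004, §7.4.1 eq. (7.145)] -/
theorem zero_mem (hd : IsSmallData Pt Q u u' δ Pt'₀) : (0 : ℝ) ∈ Ioo (-δ) δ := ⟨by linarith [hd.δ_pos], hd.δ_pos⟩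

/-- `g(0) = 1/(P̃(0)u(0)²) ≠ 0`. [cite: CoddingtonLevinson1955, Ch. 4 §8] -/
theorem g_zero_ne (hd : IsSmallData Pt Q u u' δ Pt'₀) : g Pt u 0 ≠ 0 :=
  inv_ne_zero (mul_ne_zero (hd.Pt_ne 0 (zero_mem hd)) (pow_ne_zero 2 (hd.u_ne 0 (zero_mem hd))))

/-- `g` is continuous on `(−δ, δ)`. [cite: CoddingtonLevinson1955, Ch. 4 §8] -/
theorem continuousOn_g (hd : IsSmallData Pt Q u u' δ Pt'₀) : ContinuousOn (g Pt u) (Ioo (-δ) δ) := by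
  have hu : ContinuousOn u (Ioo (-δ) δ) := fun s hs => (hd.u_deriv s hs).continuousAt.continuousWithinAt
  unfold g
  exact (hd.Pt_cont.mul (hu.pow 2)).inv₀ fun s hs => mul_ne_zero (hd.Pt_ne s hs) (pow_ne_zero 2 (hd.u_ne s hs))

/-- `g` is differentiable at `0` with derivative `gDeriv0`. [cite: CoddingtonLevinson1955, Ch. 4 §8] -/
theorem hasDerivAt_g (hd : IsSmallData Pt Q u u' δ Pt'₀) : HasDerivAt (g Pt u) (gDeriv0 Pt u u' Pt'₀) 0 := by
  have h1 : HasDerivAt (fun s => Pt s * u s ^ 2) (Pt'₀ * u 0 ^ 2 + Pt 0 * (2 * u 0 * u' 0)) 0 := by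
    have hu2 : HasDerivAt (fun s => u s ^ 2) (2 * u 0 * u' 0) 0 := by
      have := (hd.u_deriv 0 (zero_mem hd)).pow 2
      refine this.congr_deriv ?_; simp
    exact hd.Pt_deriv.mul hu2
  have hne : Pt 0 * u 0 ^ 2 ≠ 0 := mul_ne_zero (hd.Pt_ne 0 (zero_mem hd)) (pow_ne_zero 2 (hd.u_ne 0 (zero_mem hd)))
  have := h1.inv hne
  unfold g gDeriv0
  refine this.congr_deriv ?_
  ring

/-- `g(s) = g(0) + s·k(s)` for `s ≠ 0`. [cite: CoddingtonLevinson1955, Ch. 4 §8] -/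
theorem g_eq (s : ℝ) (hs : s ≠ 0) : g Pt u s = g Pt u 0 + s * k Pt u u' Pt'₀ s := by
  unfold k; rw [if_neg hs]; field_simp; ring

/-- ★ `k` is continuous on `(−δ, δ)` — through `s = 0`, where its value is `g′(0)`. [cite: CoddingtonLevinson1955, Ch. 4 §8] -/
theorem continuousOn_k (hd : IsSmallData Pt Q u u' δ Pt'₀) : ContinuousOn (k Pt u u' Pt'₀) (Ioo (-δ) δ) := by
  intro s hs
  by_cases hs0 : s = 0
  · subst hs0
    -- at 0: k = slope of g on the punctured neighbourhood, which tends to g′(0) = k 0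
    have hslope := (hasDerivAt_iff_tendsto_slope.1 (hasDerivAt_g hd))
    have heq : ∀ᶠ t in 𝓝[≠] (0 : ℝ), slope (g Pt u) 0 t = k Pt u u' Pt'₀ t := by
      filter_upwards [self_mem_nhdsWithin] with t ht
      rw [mem_compl_singleton_iff] at ht
      unfold k; rw [if_neg ht, slope_def_field, sub_zero]
    have h0 : k Pt u u' Pt'₀ 0 = gDeriv0 Pt u u' Pt'₀ := by unfold k; rw [if_pos rfl]
    have : ContinuousAt (k Pt u u' Pt'₀) 0 := by
      rw [← continuousWithinAt_compl_self, ContinuousWithinAt, h0]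
      exact hslope.congr' heq
    exact this.continuousWithinAt
  · -- away from 0: k = (g − g(0))/s
    have hg := continuousOn_g hd
    have hcont : ContinuousAt (fun t => (g Pt u t - g Pt u 0) / t) s := by
      have hga : ContinuousAt (g Pt u) s := (hg s hs).continuousAt (Ioo_mem_nhds hs.1 hs.2)
      exact (hga.sub continuousAt_const).div continuousAt_id hs0
    have heq : (fun t => (g Pt u t - g Pt u 0) / t) =ᶠ[𝓝 s] k Pt u u' Pt'₀ := by
      filter_upwards [isOpen_ne.mem_nhds hs0] with t ht
      unfold k; rw [if_neg ht]
    exact (hcont.congr heq).continuousWithinAt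

/-- ★ `h′ = k` on `(−δ, δ)` (fundamental theorem of calculus). [cite: CoddingtonLevinson1955, Ch. 4 §8] -/
theorem hasDerivAt_h (hd : IsSmallData Pt Q u u' δ Pt'₀) {s : ℝ} (hs : s ∈ Ioo (-δ) δ) :
    HasDerivAt (h Pt u u' Pt'₀) (k Pt u u' Pt'₀ s) s := by
  have hk := continuousOn_k hd
  have h0 := zero_mem hd
  have hsub : uIcc 0 s ⊆ Ioo (-δ) δ := by
    rcases le_or_gt 0 s with h | h
    · rw [uIcc_of_le h]; exact fun t ht => ⟨by linarith [h0.1, ht.1], lt_of_le_of_lt ht.2 hs.2⟩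
    · rw [uIcc_of_ge h.le]; exact fun t ht => ⟨lt_of_lt_of_le hs.1 ht.1, by linarith [h0.2, ht.2]⟩
  unfold h
  exact intervalIntegral.integral_hasDerivAt_right ((hk.mono hsub).intervalIntegrable)
    (hk.stronglyMeasurableAtFilter isOpen_Ioo s hs) ((hk s hs).continuousAt (Ioo_mem_nhds hs.1 hs.2))

/-- `h(0) = 0`. [cite: CoddingtonLevinson1955, Ch. 4 §8] -/
theorem h_zero : h Pt u u' Pt'₀ 0 = 0 := by unfold h; simp

/-- `v(0) = 0`. [cite: GoedbloedPoedts2004, §7.4.1 eq. (7.148)] -/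
theorem v_zero : v Pt u u' Pt'₀ 0 = 0 := by unfold v; rw [h_zero]; simp

/-- `v′` is the derivative of `v` on `(−δ, δ)`. [cite: GoedbloedPoedts2004, §7.4.1 eq. (7.148)] -/
theorem hasDerivAt_v (hd : IsSmallData Pt Q u u' δ Pt'₀) {s : ℝ} (hs : s ∈ Ioo (-δ) δ) :
    HasDerivAt (v Pt u u' Pt'₀) (v' Pt u u' Pt'₀ s) s := by
  unfold v v'
  have := ((hd.u_deriv s hs).mul (hasDerivAt_h hd hs)).div_const (g Pt u 0)
  exact this

/-- ★ `L′ = u′ ln|s| + u/s + v′` is the derivative of `L = u ln|s| + v` at every `s ≠ 0` of `(−δ, δ)`.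
[cite: GoedbloedPoedts2004, §7.4.1 eq. (7.148)] -/
theorem hasDerivAt_L (hd : IsSmallData Pt Q u u' δ Pt'₀) {s : ℝ} (hs : s ∈ Ioo (-δ) δ) (hs0 : s ≠ 0) :
    HasDerivAt (L Pt u u' Pt'₀) (L' Pt u u' Pt'₀ s) s := by
  unfold L L'
  have hlog : HasDerivAt (fun t : ℝ => Real.log |t|) s⁻¹ s := by
    have : (fun t : ℝ => Real.log |t|) = Real.log := funext Real.log_abs
    rw [this]; exact Real.hasDerivAt_log hs0
  have := ((hd.u_deriv s hs).mul hlog).add (hasDerivAt_v hd hs)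
  refine this.congr_deriv ?_
  rw [div_eq_mul_inv]

/-- ★★ THE LARGE SOLUTION SOLVES THE EQUATION: `(s P̃ L′)′ = Q L` at every `s ≠ 0` of `(−δ, δ)` — reduction of order:
`s P̃ L′ = (s P̃ u′)(ln|s| + h/g₀) + 1/(g₀ u)`, and the cross terms cancel because `g₀ + s k = 1/(P̃u²)`.
[cite: GoedbloedPoedts2004, §7.4.1 eqs. (7.145)–(7.148)]; [cite: CoddingtonLevinson1955, Ch. 4 §8] -/
theorem flux_hasDerivAt (hd : IsSmallData Pt Q u u' δ Pt'₀) {s : ℝ} (hs : s ∈ Ioo (-δ) δ) (hs0 : s ≠ 0) :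
    HasDerivAt (fun t => t * Pt t * L' Pt u u' Pt'₀ t) (Q s * L Pt u u' Pt'₀ s) s := by
  set g0 := g Pt u 0 with hg0def
  have hg0 : g0 ≠ 0 := g_zero_ne hd
  have hus : u s ≠ 0 := hd.u_ne s hs
  have hPs : Pt s ≠ 0 := hd.Pt_ne s hs
  -- the multiplier m = ln|s| + h/g₀ and its derivative 1/s + k/g₀
  have hlog : ∀ t : ℝ, t ≠ 0 → HasDerivAt (fun t : ℝ => Real.log |t|) t⁻¹ t := by
    intro t ht
    have : (fun t : ℝ => Real.log |t|) = Real.log := funext Real.log_abs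
    rw [this]; exact Real.hasDerivAt_log ht
  have hm : HasDerivAt (fun t => Real.log |t| + h Pt u u' Pt'₀ t / g0)
      (s⁻¹ + k Pt u u' Pt'₀ s / g0) s := (hlog s hs0).add ((hasDerivAt_h hd hs).div_const g0)
  -- the flux in product form, valid on the open set {t ≠ 0} ∩ (−δ, δ) ∩ {u ≠ 0}
  have hform : ∀ᶠ t in 𝓝 s, t * Pt t * L' Pt u u' Pt'₀ t
      = (t * Pt t * u' t) * (Real.log |t| + h Pt u u' Pt'₀ t / g0) + (g0 * u t)⁻¹ := by
    filter_upwards [isOpen_ne.mem_nhds hs0, Ioo_mem_nhds hs.1 hs.2] with t ht htI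
    have hut : u t ≠ 0 := hd.u_ne t htI
    have hPtt : Pt t ≠ 0 := hd.Pt_ne t htI
    have hgt : g Pt u t = g0 + t * k Pt u u' Pt'₀ t := g_eq t ht
    unfold L' v'
    unfold g at hgt
    rw [← hg0def]
    field_simp
    field_simp at hgt
    nlinarith [hgt]
  have hinv : HasDerivAt (fun t => (g0 * u t)⁻¹) (-(g0 * u' s) / (g0 * u s) ^ 2) s :=
    ((hd.u_deriv s hs).const_mul g0).inv (mul_ne_zero hg0 hus)
  have hprod := ((hd.u_sol s hs).mul hm).add hinv
  refine (hprod.congr_of_eventuallyEq hform).congr_deriv ?_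
  -- cancellation of the cross terms
  have hgs : g Pt u s = g0 + s * k Pt u u' Pt'₀ s := g_eq s hs0
  unfold g at hgs
  unfold L v
  rw [← hg0def]
  field_simp
  field_simp at hgs
  linear_combination (-(u' s)) * hgs

/-- ★ THE WRONSKIAN FLUX: `s P̃ (u L′ − u′ L) = 1/g₀ = P̃(0)u(0)²` at every `s ≠ 0` — `L` is independent of `u` and its
flux constant is the `P₁u₀` (times `u₀`) of `SlabContinuum.flux_large`. [cite: GoedbloedPoedts2004, §7.4.2 eq. (7.149)];
[cite: CoddingtonLevinson1955, Ch. 4 §8] -/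
theorem wronskian (hd : IsSmallData Pt Q u u' δ Pt'₀) {s : ℝ} (hs : s ∈ Ioo (-δ) δ) (hs0 : s ≠ 0) :
    s * Pt s * (u s * L' Pt u u' Pt'₀ s - u' s * L Pt u u' Pt'₀ s) = Pt 0 * u 0 ^ 2 := by
  have hus : u s ≠ 0 := hd.u_ne s hs
  have hPs : Pt s ≠ 0 := hd.Pt_ne s hs
  have hu0 : u 0 ≠ 0 := hd.u_ne 0 (zero_mem hd)
  have hP0 : Pt 0 ≠ 0 := hd.Pt_ne 0 (zero_mem hd)
  have hgs : g Pt u s = g Pt u 0 + s * k Pt u u' Pt'₀ s := g_eq s hs0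
  unfold g at hgs
  unfold L' L v' v g
  field_simp
  field_simp at hgs
  nlinarith [hgs]

/-- ★ THE LIMIT DATA: `v′` is continuous at `0` with `v′(0) = u(0)g′(0)/g(0)`; hence `v′ → v′₀` on the punctured
neighbourhood — together with `u → u(0)`, `u′ → u′(0)` (continuity) these are the hypotheses of
`SlabContinuum.flux_large` / `flux_glue_left` / `flux_glue_right`. [cite: GoedbloedPoedts2004, §7.4.2 eqs. (7.149)–(7.151)] -/
theorem tendsto_v' (hd : IsSmallData Pt Q u u' δ Pt'₀) :
    Tendsto (v' Pt u u' Pt'₀) (𝓝[≠] 0) (𝓝 (u 0 * gDeriv0 Pt u u' Pt'₀ / g Pt u 0)) := by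
  have h0 := zero_mem hd
  have hnhds : Ioo (-δ) δ ∈ 𝓝 (0 : ℝ) := Ioo_mem_nhds h0.1 h0.2
  have hu : ContinuousAt u 0 := (hd.u_deriv 0 h0).continuousAt
  have hu' : ContinuousAt u' 0 := (hd.u'_cont 0 h0).continuousAt hnhds
  have hh : ContinuousAt (h Pt u u' Pt'₀) 0 := (hasDerivAt_h hd h0).continuousAt
  have hk : ContinuousAt (k Pt u u' Pt'₀) 0 := (continuousOn_k hd 0 h0).continuousAt hnhds
  have hc : ContinuousAt (v' Pt u u' Pt'₀) 0 := by
    unfold v'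
    exact ((hu'.mul hh).add (hu.mul hk)).div_const _
  have hval : v' Pt u u' Pt'₀ 0 = u 0 * gDeriv0 Pt u u' Pt'₀ / g Pt u 0 := by
    unfold v'; rw [h_zero]; unfold k; simp
  rw [← hval]
  exact tendsto_nhdsWithin_of_tendsto_nhds hc.tendsto

/-- The small-solution limits (continuity): `u → u(0)`, `u′ → u′(0)` on the punctured neighbourhood.
[cite: GoedbloedPoedts2004, §7.4.1 eq. (7.147)] -/
theorem tendsto_u_u' (hd : IsSmallData Pt Q u u' δ Pt'₀) :
    Tendsto u (𝓝[≠] 0) (𝓝 (u 0)) ∧ Tendsto u' (𝓝[≠] 0) (𝓝 (u' 0)) ∧ Tendsto Pt (𝓝[≠] 0) (𝓝 (Pt 0)) := by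
  have h0 := zero_mem hd
  have hnhds : Ioo (-δ) δ ∈ 𝓝 (0 : ℝ) := Ioo_mem_nhds h0.1 h0.2
  exact ⟨tendsto_nhdsWithin_of_tendsto_nhds (hd.u_deriv 0 h0).continuousAt.tendsto,
    tendsto_nhdsWithin_of_tendsto_nhds ((hd.u'_cont 0 h0).continuousAt hnhds).tendsto,
    tendsto_nhdsWithin_of_tendsto_nhds ((hd.Pt_cont 0 h0).continuousAt hnhds).tendsto⟩

/-- ★ NON-SQUARE-INTEGRABILITY INPUT: the `u/s` term of `L′` — `L′ − (u′ ln|s| + v′) = u(s)/s` with `u → u₀ ≠ 0` — is the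
`1/(x − x_A)` singularity of `ξ_A′` in GP (7.154) fed to `SlabContinuum.not_sqIntegrable_principalPart`.
[cite: GoedbloedPoedts2004, §7.4.2 eq. (7.154)] -/
theorem L'_sub (s : ℝ) :
    L' Pt u u' Pt'₀ s - (u' s * Real.log |s| + v' Pt u u' Pt'₀ s) = u s / s := by
  unfold L'; ring

end SlabContinuum.ReductionOfOrder

end Literature.MathematicalPhysics.MHD
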